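import Literature.AnabelianGeometry.EtaleTheta.SettingModelKrullKummerDataEmpty
import Literature.AnabelianGeometry.EtaleTheta.SettingModelCyclotomeModEmpty
import Literature.AnabelianGeometry.EtaleTheta.RootsOfUnityPadicOrders
import HarnessLib

/-!
# The Tate-twist datum `CyclotomeMod l N` is EMPTY at the untwisted Krull models `modelκ` / `modelκ′` unless
# `N ∣ p − 1` (or `p = N = 2`) — census of the cyclotome binder of Cor. 2.9's six-member count at `κ′` (proof-only)

S. Mochizuki, *The étale theta function and its Frobenioid-theoretic manifestations*, Publ. RIMS **45** (2009) [EtTh], §2, Def. 2.13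
p. 46 («the natural isomorphism `μ_N ≅ (l·Δ_Θ) ⊗ (ℤ/Nℤ)`»; §1 p. 12 «`Δ_Θ (≅ Ẑ(1))`» as a Galois module)
[cite: MochizukiEtTh2009, Def 2.13 p.46]; J.-P. Serre, *A course in arithmetic*, Ch. II §3 (roots of unity in `ℚ_p`)
[cite: Serre1973, Ch. II §3.1 Prop. 7]. Cell abc-iut, layer L2, seat abc-iut-L2-t10 (gen 6), Krull row K11 (sequel of R488 «Cor 2.9@κ′»).

WHY. This seat's K8 six-member count `exists_temperedCoverData_natCard_cuspOrbits_inversionModelκ'` (p447856 ✓) binds, besides Prop. 2.6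
and [SemiAnbd] Thm. 6.5 (iii) (the latter FALSE at `κ′` and REMOVED by K10, `Sec2Cor29ModelKrullNormalizer`), a cyclotome datum
`μ : (modelκ′ p).CyclotomeMod 1 l` and `μ_l ⊆ K`. At the UNTWISTED Krull records the whole `(Π^tp_X)^Θ` CENTRALISES `Δ_Θ` (this
seat's K7 `toTheta_conj_eq_of_mem_deltaTheta_modelκ'` / `…_modelκ`), while `G_{ℚ_p} = aug(Π^tp_X)` MOVES a primitive `N`-th root of
unity whenever `¬(N ∣ p − 1 ∨ (p = 2 ∧ N = 2))` (abc-iut-w5-d125's `exists_galMuN_apply_ne_of_not`); the `G_K`-equivariance clause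
`red_conj` of `CyclotomeMod` then has no solution (abc-iut-w5-d125's generic `isEmpty_cyclotomeMod_of_conj_eq`) — the ROOT-MODEL census
`SettingModelCyclotomeModCensus` transcribed to the Krull carriers:

* `isEmpty_cyclotomeMod_modelκ'_of_not`, `isEmpty_cyclotomeMod_modelκ_of_not` — `CyclotomeMod l N = ∅` at `modelκ′` / `modelκ` for
  `¬(N ∣ p − 1 ∨ (p = 2 ∧ N = 2))`, every `l`;
* `isEmpty_cyclotomeMod_one_modelκ'_of_odd_not_dvd` — for ODD `l` with `¬ l ∣ p − 1` the K8 binder `μ : CyclotomeMod 1 l` is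
  UNINHABITED: the six-member count at `κ′` is VACUOUS off `l ∣ p − 1` (honest census; the positive half `l ∣ p − 1 ⇒ Nonempty`, cf.
  abc-iut-w5-d125's `nonempty_cyclotomeMod_model_of_dvd_pred` at the root model, needs a `Ẑ`-coordinate of `Δ_Θ(κ′)` and is NOT claimed here).

HONEST LIMITS: semi-synthetic models (untwisted Galois action — the very feature that kills the datum) = consistency bookkeeping for OUR
typed predicates; PROOF-ONLY (0 definitions); nothing of [EtTh] asserted; no side taken on [IUTchIII] Cor. 3.12; typed ≠ proved.
-/

noncomputable section

namespace Literature.AnabelianGeometry.EtaleTheta.SettingModel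

open Literature.AnabelianGeometry.SemiGraphs

variable (p : ℕ) [Fact p.Prime]

/-- `aug (inr σ) = σ` at the cusped Krull record. [cite: MochizukiEtTh2009, §1 p.12] -/
theorem aug_inr_modelκ' (σ : GQp p) :
    (ThetaSetting.modelκ' p).aug.toMonoidHom (SemidirectProduct.inr σ : PiTpκ p) = σ := rfl

/-- `aug (inr σ) = σ` at the Krull record. [cite: MochizukiEtTh2009, §1 p.12] -/
theorem aug_inr_modelκ (σ : GQp p) :
    (ThetaSetting.modelκ p).aug.toMonoidHom (SemidirectProduct.inr σ : PiTpκ p) = σ := rfl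

/-- **NV CERTIFICATE (negative): `CyclotomeMod l N` is EMPTY at the cusped untwisted Krull model `modelκ′` whenever
`¬(N ∣ p − 1 ∨ (p = 2 ∧ N = 2))`** — `(Π^tp_X)^Θ` centralises `Δ_Θ` (K7) while `G_{ℚ_p}` moves a primitive `N`-th root of unity.
[cite: MochizukiEtTh2009, Def 2.13 p.46] -/
theorem isEmpty_cyclotomeMod_modelκ'_of_not (l : ℕ) (N : ℕ+) (hN : ¬ ((N : ℕ) ∣ p - 1 ∨ (p = 2 ∧ (N : ℕ) = 2))) :
    IsEmpty ((ThetaSetting.modelκ' p).CyclotomeMod l N) := by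
  refine ThetaSetting.isEmpty_cyclotomeMod_of_conj_eq
    (fun g a ha => toTheta_conj_eq_of_mem_deltaTheta_modelκ' p _ a ha) ?_
  obtain ⟨σ, ζ, hne⟩ := exists_galMuN_apply_ne_of_not p N hN
  exact ⟨(SemidirectProduct.inr σ : PiTpκ p), ζ, hne⟩

/-- The same at the (cuspless) Krull record `modelκ`. [cite: MochizukiEtTh2009, Def 2.13 p.46] -/
theorem isEmpty_cyclotomeMod_modelκ_of_not (l : ℕ) (N : ℕ+) (hN : ¬ ((N : ℕ) ∣ p - 1 ∨ (p = 2 ∧ (N : ℕ) = 2))) :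
    IsEmpty ((ThetaSetting.modelκ p).CyclotomeMod l N) := by
  refine ThetaSetting.isEmpty_cyclotomeMod_of_conj_eq
    (fun g a ha => toTheta_conj_eq_of_mem_deltaTheta_modelκ p _ a ha) ?_
  obtain ⟨σ, ζ, hne⟩ := exists_galMuN_apply_ne_of_not p N hN
  exact ⟨(SemidirectProduct.inr σ : PiTpκ p), ζ, hne⟩

/-- `Nonempty` form at `modelκ′`. [cite: MochizukiEtTh2009, Def 2.13 p.46] -/
theorem not_nonempty_cyclotomeMod_modelκ'_of_not (l : ℕ) (N : ℕ+)
    (hN : ¬ ((N : ℕ) ∣ p - 1 ∨ (p = 2 ∧ (N : ℕ) = 2))) : ¬ Nonempty ((ThetaSetting.modelκ' p).CyclotomeMod l N) :=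
  not_nonempty_iff.mpr (isEmpty_cyclotomeMod_modelκ'_of_not p l N hN)

/-- A necessary condition: if `CyclotomeMod l N` is inhabited at `modelκ′` then `N ∣ p − 1 ∨ (p = 2 ∧ N = 2)`.
[cite: MochizukiEtTh2009, Def 2.13 p.46] -/
theorem dvd_pred_or_of_nonempty_cyclotomeMod_modelκ' (l : ℕ) (N : ℕ+)
    (h : Nonempty ((ThetaSetting.modelκ' p).CyclotomeMod l N)) : (N : ℕ) ∣ p - 1 ∨ (p = 2 ∧ (N : ℕ) = 2) := by
  by_contra hN
  exact not_nonempty_cyclotomeMod_modelκ'_of_not p l N hN h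

/-- **CENSUS of the K8 binder**: for ODD `l` with `¬ l ∣ p − 1`, the cyclotome datum `μ : (modelκ′ p).CyclotomeMod 1 l` of this seat's
six-member count `exists_temperedCoverData_natCard_cuspOrbits_inversionModelκ'` is UNINHABITED — that count is VACUOUS off
`l ∣ p − 1` (an odd `l` is never the exceptional `N = 2`). [cite: MochizukiEtTh2009, Cor 2.9 p.43] -/
theorem isEmpty_cyclotomeMod_one_modelκ'_of_odd_not_dvd (l : ℕ+) (hodd : Odd (l : ℕ)) (h : ¬ (l : ℕ) ∣ p - 1) :
    IsEmpty ((ThetaSetting.modelκ' p).CyclotomeMod 1 l) := by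
  refine isEmpty_cyclotomeMod_modelκ'_of_not p 1 l ?_
  rintro (hd | ⟨-, h2⟩)
  · exact h hd
  · rw [h2] at hodd
    exact (Nat.not_even_iff_odd.mpr hodd) even_two

end Literature.AnabelianGeometry.EtaleTheta.SettingModel

end
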